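import Literature.AlgebraicGeometry.HodgeTheory.TwistJetPushforwardIso
import Literature.AlgebraicGeometry.HodgeTheory.HodgeSheafPullbackForms
import Literature.AlgebraicGeometry.Modules.PullbackAlgebraUnit
import Mathlib.Algebra.Homology.Additive
import HarnessLib

/-!
# Crux stmt-HodgeConjecture-26512 `DiagLocalOfMarkmanPinnedForall`, LINE «sigma-descent-along-q» (plan-lens-HodgeAV-26512-transfer g6,
# 2026-08-29): **NORMALISATION OF (Dq-σ) ON `0`-FORMS** — critic price S-4 (idea-crit-6 g5, RULING 26512 sigma-descent-along-q,
# «run falsifier (i) `E := 𝒪_Y[0]`, `q₀ = 0` FIRST on the typed (Dq-σ) equation») PRE-CHECKED: at `q₀ = 0` the forms comparison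
# `[dq]` of `SigmaDescent.formsSingleComparison D 0` IS the unit comparison `[u]` of `SigmaDescent.unitSingleComparison D`, conjugated by
# the canonical `Ω⁰ ≅ 𝒪` on both schemes — so the two comparison maps of the (Dq-σ) square cannot be normalised inconsistently.

research route conditional on HC_CM; not a corollary; Q11.4-sentence-2 already refuted in dim ≥ 3. Nothing here proves (Dq-σ) = (L2)
`SigmaPullbackCompat`, (Dq-Inj) = (L1), (U-Σ), (N-U), (S4), any registered stub, the crux, №4, HC_AV, HC_CM or HC; typed ≠ proved.
EVERYTHING BELOW IS PROVED (no `sorry`, no named fact); it is Literature-level bookkeeping for an ARBITRARY morphism `g : X₀ ⟶ X₁` of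
`S`-schemes, written here (Cruxes lane, seat ACL) because the only tree statement of this kind, `hodgeSheafZeroIso_inv_comp_comap`
(`HodgeTheory/TwistJetPushforwardIso`), is typed for an ISOMORPHISM `e : X₀ ≅ X₁`; the (L2) typer may move it to `HodgeTheory/`.

* (N0) `hodgeSheafZeroIso_inv_comp_comap_of_hom` — **pull-back of `0`-forms is `g♯`**: `(𝒪 ≅ Ω⁰)⁻¹_{X₁} ≫ g^♯ = g♯ ≫ g_*((𝒪 ≅ Ω⁰)⁻¹_{X₀})`
  as morphisms `𝒪_{X₁} ⟶ g_*Ω⁰_{X₀}` (`g^♯ = hodgeSheaf.comap g 0`, `g♯ = algebraUnit g.left`; same six-line sections proof as the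
  isomorphism case).
* (N0′) `pullbackForms_zero_eq` — **`dg` on `0`-forms in pull-back form**: `pullbackForms g 0 = g^*[(Ω⁰ ≅ 𝒪)_{X₁}] ≫ (g^*(g♯) ≫ ε_{𝒪_{X₀}}) ≫
  (𝒪 ≅ Ω⁰)⁻¹_{X₀}` (transpose of (N0) under `g^* ⊣ g_*`; the middle factor is the canonical `g^*𝒪_{X₁} ⟶ 𝒪_{X₀}`, an isomorphism by
  `isIso_pullback_map_algebraUnit_comp_counit`).
* (N0″) `formsSingleComparison'_zero` — the SINGLE-COMPLEX form consumed by (Dq-σ): with `unitSingleComparison' g` ∕ `formsSingleComparison' g q₀`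
  = the bodies of `SigmaDescent.unitSingleComparison D` ∕ `SigmaDescent.formsSingleComparison D q₀` (`Cruxes/…/SigmaDescent.lean` 7c4a19848ae2
  l.100–125) for a general `g` (there `g := D.q.hom.hom.hom`, `g.left ≡ Hom.toSchemeHom D.q`),
  **`formsSingleComparison' g 0 = g^*•[Ω⁰ ≅ 𝒪]_{X₁}[0] ≫ unitSingleComparison' g ≫ [𝒪 ≅ Ω⁰]⁻¹… _{X₀}[0]`**.

CONSEQUENCE FOR S-4 (pencil, recorded on the card `Ideas/sigma-descent-along-q.md` v1.1): at `(E, q₀) = (𝒪_Y[0], 0)` the typed (Dq-σ) equation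
`[u] ≫ σ₀^{q^*E}(q^{**}x) = q^{**}(σ₀^{E}x) ≫ [dq]⟦2⟧'` has, by (N0″), the SAME canonical comparison on source and target; what remains is the
unit ∕ supertrace normalisation of `HomComplex.sigmaC` at `K = 𝒪[0]`, whose definitions are uniform in the scheme — i.e. pieces (Q2) (unit) and
(Q5) (supertrace) of the (L2) plan at one object, not a convention trap. The integer degree `((q₀ + 2 : ℕ) : ℤ)` is `sigmaC`'s own output typing on
both schemes (no cast is inserted by `pullbackExt`).

References: [cite: Hartshorne1977, II Prop. 8.11 (f^*Ω_{Y/S} → Ω_{X/S}; on 0-forms it is f♯) and II §5 p. 110 (f^* ⊣ f_*)]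
[cite: StacksProject, Tag 01AK (`f^*𝒪_Y = 𝒪_X`) and Tag 0BVH (`𝒪_Y → f_*𝒪_X`)] [cite: BuchweitzFlenner2003, Def. 4.1 (the `q = 0` component of σ is the trace)]
[cite: Markman2025SecantWeil, §9.3 Lemma 9.3.9 (the commutative square with edges σ and q^*σ)].
-/

noncomputable section

-- `TopCat.Presheaf`/`Scheme.Modules` are not reducible (as in Mathlib's `AlgebraicGeometry/Modules/Sheaf.lean`).
set_option backward.isDefEq.respectTransparency false

open CategoryTheory CategoryTheory.Category AlgebraicGeometry Opposite TopologicalSpace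
open AlgebraicGeometry.Scheme.Modules

namespace Summit.HodgeConjecture.HodgeConjecture.Cruxes.DiagLocalOfMarkmanPinnedForall.SigmaDescent

set_option linter.dupNamespace false -- the Cruxes namespace repeats the summit name, as in every file of this directory

open Literature.AlgebraicGeometry.Modules Literature.AlgebraicGeometry.Motives Literature.AlgebraicGeometry.HodgeTheory

universe u

variable {S : Type u} [CommRing S] {X₀ X₁ : Over (Spec (CommRingCat.of S))} (g : X₀ ⟶ X₁)

/-! ## (N0) Pull-back of `0`-forms is `g♯` -/

/-- **(N0) Pull-back of `0`-forms is `g♯` on functions**, for an ARBITRARY morphism `g : X₀ ⟶ X₁` of `S`-schemes: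
`(𝒪 ≅ Ω⁰)⁻¹_{X₁} ≫ g^♯ = g♯ ≫ g_*((𝒪 ≅ Ω⁰)⁻¹_{X₀})` as morphisms `𝒪_{X₁} ⟶ g_*Ω⁰_{X₀}` (the tree's `hodgeSheafZeroIso_inv_comp_comap` is the case of an
isomorphism; same proof: both sides send `a ∈ Γ(U, 𝒪_{X₁})` to the `0`-form `(g♯a · ())^sh` on `g⁻¹U`).
[cite: Hartshorne1977, II Prop. 8.11 (the pull-back of differentials f^*Ω_{Y/S} → Ω_{X/S}; reading: on 0-forms it is f♯)] [cite: StacksProject, Tag 0BVH] -/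
theorem hodgeSheafZeroIso_inv_comp_comap_of_hom :
    (hodgeSheafZeroIso X₁).inv ≫ hodgeSheaf.comap g 0 =
      algebraUnit g.left ≫ (pushforward g.left).map (hodgeSheafZeroIso X₀).inv := by
  refine Scheme.Modules.hom_ext _ _ fun U => AddCommGrpCat.ext fun (a : Γ(X₁.left, U)) => ?_
  change (hodgeSheaf.comap g 0).app U ((hodgeSheafZeroIso X₁).inv.app U a) =
    (hodgeSheafZeroIso X₀).inv.app (g.left ⁻¹ᵁ U) (g.left.app U a)
  rw [hodgeSheafZeroIso_inv_app, hodgeSheafZeroIso_inv_app]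
  erw [exteriorPower_iso₀_inv_apply, exteriorPower_iso₀_inv_apply, hodgeSheaf.comap_app_toHodgeSheaf,
    comapWedge_smul, comapWedge_mk]
  congr 2

/-- (N0) read forwards: `g^♯` on `0`-forms is `g♯` conjugated by `Ω⁰ ≅ 𝒪`. [cite: Hartshorne1977, II Prop. 8.11 (reading: on 0-forms the pull-back of forms is f♯)] -/
theorem hodgeSheaf_comap_zero_eq :
    hodgeSheaf.comap g 0 =
      (hodgeSheafZeroIso X₁).hom ≫ algebraUnit g.left ≫ (pushforward g.left).map (hodgeSheafZeroIso X₀).inv :=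
  (Iso.inv_comp_eq _).mp (hodgeSheafZeroIso_inv_comp_comap_of_hom g)

/-! ## (N0′) `dg` on `0`-forms in pull-back form -/

/-- **(N0′) `dg` on `0`-forms, pull-back form**: `pullbackForms g 0 = g^*[(Ω⁰ ≅ 𝒪)_{X₁}] ≫ (g^*(g♯) ≫ ε_{𝒪_{X₀}}) ≫ (𝒪 ≅ Ω⁰)⁻¹_{X₀}` — the middle factor
is the canonical `g^*𝒪_{X₁} ⟶ 𝒪_{X₀}` (`pullback_map_algebraUnit_comp_counit`, an isomorphism by `isIso_pullback_map_algebraUnit_comp_counit`).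
Transpose of (N0) under `g^* ⊣ g_*` (`pullbackForms` is DEFINED as the transpose of `hodgeSheaf.comap`; Mathlib `Adjunction.homEquiv_counit`,
`Adjunction.counit_naturality`). [cite: Hartshorne1977, II Prop. 8.11 and II §5 p. 110 (f^* ⊣ f_*)] [cite: StacksProject, Tag 01AK (`f^*𝒪_Y = 𝒪_X`)] -/
theorem pullbackForms_zero_eq :
    pullbackForms g 0 =
      (pullback g.left).map (hodgeSheafZeroIso X₁).hom ≫ (pullback g.left).map (algebraUnit g.left) ≫
        (pullbackPushforwardAdjunction g.left).counit.app (unitModule X₀.left) ≫ (hodgeSheafZeroIso X₀).inv := by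
  unfold pullbackForms
  rw [Adjunction.homEquiv_counit, hodgeSheaf_comap_zero_eq, Functor.map_comp, Functor.map_comp, Category.assoc, Category.assoc,
    Adjunction.counit_naturality]

/-! ## (N0″) The single-complex comparisons of `SigmaDescent.lean`, for a general `g`, and their agreement at `q₀ = 0` -/

/-- **`g^*•(𝒪_{X₁}[0]) ⟶ 𝒪_{X₀}[0]`** — the body of `SigmaDescent.unitSingleComparison D` for an arbitrary morphism of `S`-schemes (single-degree
commutation `singleMapHomologicalComplex`, then `[g^*(g♯) ≫ ε]`). [cite: StacksProject, Tag 01AK (`f^*𝒪_Y = 𝒪_X`)] -/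
def unitSingleComparison' :
    ((pullback g.left).mapHomologicalComplex (ComplexShape.up ℤ)).obj
        ((HomologicalComplex.single X₁.left.Modules (ComplexShape.up ℤ) 0).obj (unitModule X₁.left)) ⟶
      (HomologicalComplex.single X₀.left.Modules (ComplexShape.up ℤ) 0).obj (unitModule X₀.left) :=
  (HomologicalComplex.singleMapHomologicalComplex (pullback g.left) (ComplexShape.up ℤ) 0).hom.app (unitModule X₁.left) ≫
    (HomologicalComplex.single X₀.left.Modules (ComplexShape.up ℤ) 0).map
      ((pullback g.left).map (algebraUnit g.left) ≫ (pullbackPushforwardAdjunction g.left).counit.app (unitModule X₀.left))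

/-- **`g^*•(Ω^{q₀}_{X₁}[0]) ⟶ Ω^{q₀}_{X₀}[0]`** — the body of `SigmaDescent.formsSingleComparison D q₀` for an arbitrary morphism of `S`-schemes
(single-degree commutation, then `[dg]` on `q₀`-forms = `pullbackForms g q₀`). [cite: Hartshorne1977, II Prop. 8.11 (the pull-back f^*Ω_{Y/S} → Ω_{X/S})] -/
def formsSingleComparison' (q₀ : ℕ) :
    ((pullback g.left).mapHomologicalComplex (ComplexShape.up ℤ)).obj
        ((HomologicalComplex.single X₁.left.Modules (ComplexShape.up ℤ) 0).obj (hodgeSheaf X₁ q₀)) ⟶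
      (HomologicalComplex.single X₀.left.Modules (ComplexShape.up ℤ) 0).obj (hodgeSheaf X₀ q₀) :=
  (HomologicalComplex.singleMapHomologicalComplex (pullback g.left) (ComplexShape.up ℤ) 0).hom.app (hodgeSheaf X₁ q₀) ≫
    (HomologicalComplex.single X₀.left.Modules (ComplexShape.up ℤ) 0).map (pullbackForms g q₀)

/-- **(N0″) At `q₀ = 0` the forms comparison IS the unit comparison, up to the canonical `Ω⁰ ≅ 𝒪` on both schemes**:
`formsSingleComparison' g 0 = g^*•([Ω⁰ ≅ 𝒪]_{X₁}[0]) ≫ unitSingleComparison' g ≫ ([𝒪 ≅ Ω⁰]… )⁻¹_{X₀}[0]` ((N0′) placed in degree `0`; naturality of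
`singleMapHomologicalComplex` in the module). This is the `q₀ = 0` normalisation behind critic price S-4 of LINE «sigma-descent-along-q»: the two
comparison maps `[u]`, `[dq]` of the (Dq-σ) square agree on `0`-forms. [cite: Hartshorne1977, II Prop. 8.11 (reading: on 0-forms the pull-back of forms is f♯)]
[cite: Markman2025SecantWeil, §9.3 Lemma 9.3.9 (the commutative square with edges σ and q^*σ; reading)] -/
theorem formsSingleComparison'_zero :
    formsSingleComparison' g 0 =
      ((pullback g.left).mapHomologicalComplex (ComplexShape.up ℤ)).map
          ((HomologicalComplex.single X₁.left.Modules (ComplexShape.up ℤ) 0).map (hodgeSheafZeroIso X₁).hom) ≫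
        unitSingleComparison' g ≫
          (HomologicalComplex.single X₀.left.Modules (ComplexShape.up ℤ) 0).map (hodgeSheafZeroIso X₀).inv := by
  have hN := (HomologicalComplex.singleMapHomologicalComplex (pullback g.left) (ComplexShape.up ℤ) 0).hom.naturality
    (hodgeSheafZeroIso X₁).hom
  simp only [Functor.comp_map] at hN
  simp only [formsSingleComparison', unitSingleComparison', Category.assoc]
  rw [reassoc_of% hN, pullbackForms_zero_eq]
  simp only [Functor.map_comp, Category.assoc]

end Summit.HodgeConjecture.HodgeConjecture.Cruxes.DiagLocalOfMarkmanPinnedForall.SigmaDescent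

end
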